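import Summits.AnomalousDissipation.AnomalousDissipation.Theorems.DenseLoudDesignerForces.Negative.WindowBounds

/-!
# Negative knowledge for the crux `DenseLoudDesignerForces` (stmt-AnomalousDissipation-1143), V: the convective
# term is load-bearing

Certified copy of §7 of the cdisprove work file: `DenseLoudDesignerForcesWithoutConvection` — the crux verbatim
with witnesses solving the LINEAR Stokes system — is FALSE for every stock, all budgets and every window
(`denseLoudDesignerForces_false_without_convection`).  Mechanism: Stokes self-pairing
`∫‖f_c‖² ≤ (ν/2)(E + ‖Δf_c‖²_∞)` plus the power budget give `ε² ≤ E(E + Λ₂(c)²)/(2(j+1))` on the Stokes loud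
sets.  Hence any proof of the crux must extract an O(1) mean Reynolds stress `τ⁻¹∫₀^τ∫⟪u,(u·∇)f_c⟫` at bounded
energy as `ν → 0`.  Supports stmt-AnomalousDissipation-1143.
-/

noncomputable section

namespace Summit.AnomalousDissipation.AnomalousDissipation.Theorems.DenseLoudDesignerForces.Negative

open scoped BigOperators Topology ENNReal InnerProductSpace
open Filter Set MeasureTheory UnitAddTorus
open Literature.Analysis.FunctionSpaces Literature.Analysis.FluidPDE
open Summit.AnomalousDissipation.AnomalousDissipation.Theses.BaireTransfer

/-! ## §7 LOAD-BEARING HYPOTHESIS: the convective nonlinearity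

Delete `(u·∇)u` from the witness notion (classical periodic solutions of the forced LINEAR Stokes system,
everything else verbatim).  Then the crux is FALSE for every stock, every budget and every window:
pairing the Stokes equation with the force itself gives `∫‖f_c‖² = -ν τ⁻¹∫₀^τ∫⟪u, Δf_c⟫ ≤ (ν/2)(E + ‖Δf_c‖²_∞)`,
so with the power budget `ε² ≤ (∫‖f_c‖²)E ≤ E(E + Λ₂(c)²)/(2(j+1)) → 0` along the levels, uniformly on
bounded sets of coefficients: LINEAR DESIGNER FORCING IS UNIFORMLY QUIET.  Any proof of the crux must use the
trilinear term `∫₀^τ∫⟪u,(u·∇)f_c⟫` of `momentum_period_identity` to keep `∫‖f_c‖²` (hence the injected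
power) of order one as `ν → 0` — i.e. an O(1) mean Reynolds stress against the force at bounded energy. -/

section Stokes

/-- Classical (jointly smooth) solutions of the forced LINEAR STOKES system `∂ₜu = νΔu - ∇p + f`,
`div u = 0` on `T³ × Sset` — `Torus.IsClassicalNSSolutionOn` with the convective term deleted. -/
structure IsClassicalStokesSolutionOn (Sset : Set ℝ) (ν : ℝ) (f u : ℝ → (UnitAddTorus (Fin 3)) → (EuclideanSpace ℝ (Fin 3))) (p : ℝ → (UnitAddTorus (Fin 3)) → ℝ) :
    Prop where
  smooth_velocity : Torus.IsSmoothSpaceTimeOn Sset u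
  smooth_pressure : Torus.IsSmoothSpaceTimeOn Sset p
  momentum : ∀ t ∈ Sset, ∀ x,
    Torus.timeDerivWithin Sset u t x = ν • Torus.laplacian (u t) x - Torus.gradient (p t) x + f t x
  divFree : ∀ t ∈ Sset, Torus.IsDivFree (u t)

/-- The STOKES LOUD SET: the crux's `LOUD_j(S,E,ε)` with linear Stokes witnesses. -/
def stokesLoudSet (S : Finset (Fin 3 → ℤ)) (E ε : ℝ) (j : ℕ) : Set (↥S → (EuclideanSpace ℂ (Fin 3))) :=
  {c : ↥S → (EuclideanSpace ℂ (Fin 3)) | ∃ ν : ℝ, 0 < ν ∧ ν < 1 / ((j : ℝ) + 1) ∧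
    ∃ (τ : ℝ) (u : ℝ → (UnitAddTorus (Fin 3)) → (EuclideanSpace ℝ (Fin 3))) (p : ℝ → (UnitAddTorus (Fin 3)) → ℝ), 0 < τ ∧
      IsClassicalStokesSolutionOn Set.univ ν (fun _ => force S c) u p ∧
      Function.Periodic u τ ∧ meanEnergy u ≤ E ∧ ε ≤ meanDissipation ν u}

/-- `DenseLoudDesignerForces` WITHOUT CONVECTION: the crux verbatim, witnesses solving linear Stokes. -/
def DenseLoudDesignerForcesWithoutConvection : Prop :=
  ∀ S₀ : Finset (Fin 3 → ℤ), ∃ S : Finset (Fin 3 → ℤ), S₀ ⊆ S ∧ ∃ (E ε : ℝ), 0 < ε ∧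
    ∃ U : Set (↥S → (EuclideanSpace ℂ (Fin 3))), IsOpen U ∧ U.Nonempty ∧ ∀ j : ℕ, U ⊆ closure (stokesLoudSet S E ε j)

variable {ν τ : ℝ} {F : (UnitAddTorus (Fin 3)) → (EuclideanSpace ℝ (Fin 3))} {u : ℝ → (UnitAddTorus (Fin 3)) → (EuclideanSpace ℝ (Fin 3))} {p : ℝ → (UnitAddTorus (Fin 3)) → ℝ} {φ : (UnitAddTorus (Fin 3)) → (EuclideanSpace ℝ (Fin 3))}

/-- The force of a global classical Stokes solution is smooth (`F = ∂ₜu - νΔu + ∇p`). -/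
theorem IsClassicalStokesSolutionOn.isSmooth_force (h : IsClassicalStokesSolutionOn univ ν (fun _ => F) u p) :
    Torus.IsSmooth F := by
  have hu := h.smooth_velocity
  have hut : Torus.IsSmooth (u 0) := hu.isSmooth_slice (mem_univ 0)
  have hpt : Torus.IsSmooth (p 0) := h.smooth_pressure.isSmooth_slice (mem_univ 0)
  have hsm : Torus.IsSmooth (fun x => Torus.timeDerivWithin univ u 0 x -
      ν • Torus.laplacian (u 0) x + Torus.gradient (p 0) x) :=
    ((((hu.timeDerivWithin uniqueDiffOn_univ).isSmooth_slice (mem_univ 0))).sub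
      (hut.laplacian.smul ν)).add hpt.gradient
  have hFeq : F = fun x => Torus.timeDerivWithin univ u 0 x -
      ν • Torus.laplacian (u 0) x + Torus.gradient (p 0) x := by
    funext x
    have hm := h.momentum 0 (mem_univ 0) x
    calc F x = (ν • Torus.laplacian (u 0) x - Torus.gradient (p 0) x + F x) -
        ν • Torus.laplacian (u 0) x + Torus.gradient (p 0) x := by abel
      _ = _ := by rw [← hm]
  rw [hFeq]; exact hsm

/-- Paired Stokes equation: `∫⟪∂ₜu, φ⟫ = ν∫⟪u, Δφ⟫ + ∫⟪F, φ⟫` for smooth solenoidal `φ` (no trilinear term). -/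
theorem IsClassicalStokesSolutionOn.integral_inner_timeDeriv_eq
    (h : IsClassicalStokesSolutionOn univ ν (fun _ => F) u p)
    (hφ : Torus.IsSmooth φ) (hdiv : Torus.IsDivFree φ) (t : ℝ) :
    ∫ x, ⟪Torus.timeDerivWithin univ u t x, φ x⟫_ℝ =
      ν * (∫ x, ⟪u t x, Torus.laplacian φ x⟫_ℝ) + ∫ x, ⟪F x, φ x⟫_ℝ := by
  have hu := h.smooth_velocity
  have hF : Torus.IsSmooth F := h.isSmooth_force
  have hut : Torus.IsSmooth (u t) := hu.isSmooth_slice (mem_univ t)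
  have hpt : Torus.IsSmooth (p t) := h.smooth_pressure.isSmooth_slice (mem_univ t)
  have hpoint : (fun x => ⟪Torus.timeDerivWithin univ u t x, φ x⟫_ℝ) = fun x =>
      ν * ⟪Torus.laplacian (u t) x, φ x⟫_ℝ - ⟪φ x, Torus.gradient (p t) x⟫_ℝ + ⟪F x, φ x⟫_ℝ := by
    funext x
    rw [h.momentum t (mem_univ t) x, inner_add_left, inner_sub_left, real_inner_smul_left,
      real_inner_comm (φ x) (Torus.gradient (p t) x)]
  rw [hpoint]
  have i1 : Integrable (fun x => ν * ⟪Torus.laplacian (u t) x, φ x⟫_ℝ) :=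
    ((hut.laplacian.inner hφ).integrable).const_mul ν
  have i2 : Integrable (fun x => ⟪φ x, Torus.gradient (p t) x⟫_ℝ) := (hφ.inner hpt.gradient).integrable
  have i3 : Integrable (fun x => ⟪F x, φ x⟫_ℝ) := (hF.inner hφ).integrable
  have i12 : Integrable (fun x => ν * ⟪Torus.laplacian (u t) x, φ x⟫_ℝ - ⟪φ x, Torus.gradient (p t) x⟫_ℝ) :=
    i1.sub i2
  rw [integral_add i12 i3, integral_sub i1 i2, integral_const_mul, Torus.integral_inner_laplacian_comm hut hφ,
    Torus.integral_inner_gradient_eq_neg_integral_mul_divergence_holds hφ hpt]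
  have hdiv0 : (fun x => p t x * Torus.divergence φ x) = fun _ => (0 : ℝ) :=
    funext fun x => by rw [hdiv x, mul_zero]
  rw [hdiv0, integral_zero]
  ring

/-- Stokes momentum period identity: `τ ∫⟪F, φ⟫ = -ν ∫₀^τ ∫⟪u, Δφ⟫`. -/
theorem IsClassicalStokesSolutionOn.momentum_period_identity
    (h : IsClassicalStokesSolutionOn univ ν (fun _ => F) u p)
    (hφ : Torus.IsSmooth φ) (hdiv : Torus.IsDivFree φ) (hper : Function.Periodic u τ) :
    τ * ∫ x, ⟪F x, φ x⟫_ℝ = -(ν * ∫ t in (0 : ℝ)..τ, ∫ x, ⟪u t x, Torus.laplacian φ x⟫_ℝ) := by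
  have hu := h.smooth_velocity
  have h0 := period_integral_pairing_deriv hu hφ hper
  have hfun : (fun t => ∫ x, ⟪Torus.timeDerivWithin univ u t x, φ x⟫_ℝ) = fun t =>
      ν * (∫ x, ⟪u t x, Torus.laplacian φ x⟫_ℝ) + ∫ x, ⟪F x, φ x⟫_ℝ :=
    funext fun t => h.integral_inner_timeDeriv_eq hφ hdiv t
  rw [hfun] at h0
  have hC2 : Continuous fun t => ∫ x, ⟪u t x, Torus.laplacian φ x⟫_ℝ :=
    continuousOn_univ.1 ((hu.inner (Torus.isSmoothSpaceTimeOn_const hφ.laplacian univ)).continuousOn_integral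
      convex_univ)
  have hI2 : IntervalIntegrable (fun t => ν * ∫ x, ⟪u t x, Torus.laplacian φ x⟫_ℝ) volume 0 τ :=
    (hC2.intervalIntegrable _ _).const_mul ν
  have hI3 : IntervalIntegrable (fun _ : ℝ => ∫ x, ⟪F x, φ x⟫_ℝ) volume 0 τ := intervalIntegrable_const
  rw [intervalIntegral.integral_add hI2 hI3, intervalIntegral.integral_const_mul,
    intervalIntegral.integral_const, sub_zero, smul_eq_mul] at h0
  linarith

/-- `∫⟪u, Δu⟫ = -‖∇u‖₂²` for smooth `u` (pointwise gradient norm). -/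
theorem integral_inner_laplacian_self {v : (UnitAddTorus (Fin 3)) → (EuclideanSpace ℝ (Fin 3))} (hv : Torus.IsSmooth v) :
    ∫ x, ⟪v x, Torus.laplacian v x⟫_ℝ = -Torus.gradNormSq v := by
  rw [Torus.integral_inner_laplacian_eq_neg_holds hv, Torus.gradNormSq,
    integral_finsetSum _ fun i _ => (hv.partialDeriv i).norm_sq.integrable]

/-- Stokes energy over a period: `ν ∫₀^τ ‖∇u‖₂² = ∫₀^τ ∫⟪F, u⟫`. -/
theorem IsClassicalStokesSolutionOn.period_dissipation_eq_power
    (h : IsClassicalStokesSolutionOn univ ν (fun _ => F) u p) (hper : Function.Periodic u τ) :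
    ν * ∫ t in (0 : ℝ)..τ, Torus.gradNormSq (u t) = ∫ t in (0 : ℝ)..τ, ∫ x, ⟪F x, u t x⟫_ℝ := by
  have hu := h.smooth_velocity
  have hF := h.isSmooth_force
  -- `d/dt ∫‖u‖² = 2∫⟪∂ₜu, u⟫ = 2(-ν‖∇u‖² + ∫⟪F,u⟫)`
  have hG : Torus.IsSmoothSpaceTimeOn univ (fun s x => ⟪u s x, u s x⟫_ℝ) := hu.inner hu
  have hg : Continuous fun t => Torus.gradNormSq (u t) :=
    continuousOn_univ.1 (hu.continuousOn_gradNormSq convex_univ uniqueDiffOn_univ)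
  have hP : Continuous fun t => ∫ x, ⟪F x, u t x⟫_ℝ :=
    continuousOn_univ.1 (((Torus.isSmoothSpaceTimeOn_const hF univ).inner hu).continuousOn_integral convex_univ)
  have hderiv : ∀ t, HasDerivAt (fun s => ∫ x, ⟪u s x, u s x⟫_ℝ)
      (2 * (ν * -Torus.gradNormSq (u t) + ∫ x, ⟪F x, u t x⟫_ℝ)) t := by
    intro t
    have hut : Torus.IsSmooth (u t) := hu.isSmooth_slice (mem_univ t)
    have h1 := hG.hasDerivWithinAt_integral convex_univ (mem_univ t)
    have h2 : (fun x => Torus.timeDerivWithin univ (fun s y => ⟪u s y, u s y⟫_ℝ) t x) =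
        fun x => 2 * ⟪Torus.timeDerivWithin univ u t x, u t x⟫_ℝ := by
      funext x
      rw [hu.timeDerivWithin_inner hu uniqueDiffOn_univ (mem_univ t) x, real_inner_comm, two_mul]
    rw [h2, integral_const_mul, h.integral_inner_timeDeriv_eq hut (h.divFree t (mem_univ t)) t,
      integral_inner_laplacian_self hut] at h1
    exact h1.hasDerivAt univ_mem
  have hcont : Continuous fun t => 2 * (ν * -Torus.gradNormSq (u t) + ∫ x, ⟪F x, u t x⟫_ℝ) :=
    continuous_const.mul ((continuous_const.mul hg.neg).add hP)
  have hFTC := intervalIntegral.integral_eq_sub_of_hasDerivAt (a := 0) (b := τ) (fun t _ => hderiv t)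
    (hcont.intervalIntegrable _ _)
  have h0 : u τ = u 0 := by simpa using hper 0
  rw [h0, sub_self] at hFTC
  have hI1 : IntervalIntegrable (fun t => ν * -Torus.gradNormSq (u t)) volume 0 τ :=
    (continuous_const.mul hg.neg).intervalIntegrable _ _
  have hI2 : IntervalIntegrable (fun t => ∫ x, ⟪F x, u t x⟫_ℝ) volume 0 τ := hP.intervalIntegrable _ _
  have hneg : (∫ t in (0 : ℝ)..τ, ν * -Torus.gradNormSq (u t)) = -(ν * ∫ t in (0 : ℝ)..τ, Torus.gradNormSq (u t)) := by
    rw [intervalIntegral.integral_const_mul, ← mul_neg, intervalIntegral.integral_neg]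
  rw [intervalIntegral.integral_const_mul, intervalIntegral.integral_add hI1 hI2, hneg] at hFTC
  linarith

/-- Stokes power identity: `meanDissipation ν u = τ⁻¹ ∫₀^τ ∫⟪F, u⟫`. -/
theorem IsClassicalStokesSolutionOn.meanDissipation_eq_meanPower
    (h : IsClassicalStokesSolutionOn univ ν (fun _ => F) u p) (hper : Function.Periodic u τ) (hτ : 0 < τ) :
    meanDissipation ν u = τ⁻¹ * ∫ t in (0 : ℝ)..τ, ∫ x, ⟪F x, u t x⟫_ℝ := by
  rw [meanDissipation_eq_period_mean h.smooth_velocity hper hτ, h.period_dissipation_eq_power hper]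

/-- Stokes power budget: `meanDissipation² ≤ (∫‖F‖²)·meanEnergy`. -/
theorem IsClassicalStokesSolutionOn.meanDissipation_sq_le
    (h : IsClassicalStokesSolutionOn univ ν (fun _ => F) u p) (hν : 0 ≤ ν)
    (hper : Function.Periodic u τ) (hτ : 0 < τ) :
    meanDissipation ν u ^ 2 ≤ (∫ x, ‖F x‖ ^ 2) * meanEnergy u := by
  have hD : 0 ≤ meanDissipation ν u := by
    rw [meanDissipation_eq_of_periodic hper hτ]
    refine mul_nonneg (inv_nonneg.2 hτ.le) (intervalIntegral.integral_nonneg hτ.le fun t _ => ?_)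
    exact mul_nonneg hν ENNReal.toReal_nonneg
  exact power_budget_core h.smooth_velocity h.isSmooth_force hper hτ hD (h.meanDissipation_eq_meanPower hper hτ)

/-- STOKES SELF-PAIRING: `∫‖F‖² ≤ (ν/2)(meanEnergy + ∫‖ΔF‖²)` for a periodic Stokes orbit with solenoidal
smooth steady force — the force a bounded-energy LINEAR orbit can carry VANISHES with the viscosity. -/
theorem IsClassicalStokesSolutionOn.forceEnergy_le
    (h : IsClassicalStokesSolutionOn univ ν (fun _ => F) u p) (hν : 0 ≤ ν) (hdivF : Torus.IsDivFree F)
    (hper : Function.Periodic u τ) (hτ : 0 < τ) :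
    ∫ x, ‖F x‖ ^ 2 ≤ ν / 2 * (meanEnergy u + ∫ x, ‖Torus.laplacian F x‖ ^ 2) := by
  have hu := h.smooth_velocity
  have hF := h.isSmooth_force
  have hid := h.momentum_period_identity hF hdivF hper
  have heq : ∫ x, ⟪F x, F x⟫_ℝ = ∫ x, ‖F x‖ ^ 2 :=
    integral_congr_ae (ae_of_all _ fun x => real_inner_self_eq_norm_sq _)
  rw [heq] at hid
  have he_st : Torus.IsSmoothSpaceTimeOn univ (fun t x => ‖u t x‖ ^ 2) := by
    change ContDiffOn ℝ _ (fun z => ‖Torus.stLift u z‖ ^ 2) _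
    exact hu.norm_sq ℝ
  have he_cont : Continuous fun t => ∫ x, ‖u t x‖ ^ 2 :=
    continuousOn_univ.1 (he_st.continuousOn_integral convex_univ)
  set e : ℝ → ℝ := fun t => ∫ x, ‖u t x‖ ^ 2 with he_def
  set L : ℝ := ∫ x, ‖Torus.laplacian F x‖ ^ 2 with hL_def
  have hlap_pt : ∀ t, |∫ x, ⟪u t x, Torus.laplacian F x⟫_ℝ| ≤ (e t + L) / 2 := by
    intro t
    have hut : Torus.IsSmooth (u t) := hu.isSmooth_slice (mem_univ t)
    have hint : Integrable (fun x => (‖u t x‖ ^ 2 + ‖Torus.laplacian F x‖ ^ 2) / 2) :=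
      (hut.norm_sq.integrable.add hF.laplacian.norm_sq.integrable).div_const 2
    have hb := norm_integral_le_of_norm_le hint (ae_of_all _ fun x =>
      show ‖⟪u t x, Torus.laplacian F x⟫_ℝ‖ ≤ (‖u t x‖ ^ 2 + ‖Torus.laplacian F x‖ ^ 2) / 2 from by
        rw [Real.norm_eq_abs]
        calc |⟪u t x, Torus.laplacian F x⟫_ℝ| ≤ ‖u t x‖ * ‖Torus.laplacian F x‖ := abs_real_inner_le_norm _ _
          _ ≤ (‖u t x‖ ^ 2 + ‖Torus.laplacian F x‖ ^ 2) / 2 := by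
              nlinarith [sq_nonneg (‖u t x‖ - ‖Torus.laplacian F x‖)])
    rw [Real.norm_eq_abs, integral_div, integral_add hut.norm_sq.integrable hF.laplacian.norm_sq.integrable] at hb
    exact hb
  have hlap_time : |∫ t in (0 : ℝ)..τ, ∫ x, ⟪u t x, Torus.laplacian F x⟫_ℝ| ≤
      ((∫ t in (0 : ℝ)..τ, e t) + τ * L) / 2 := by
    have := intervalIntegral.norm_integral_le_of_norm_le hτ.le
      (ae_of_all _ fun t _ => (Real.norm_eq_abs _).trans_le (hlap_pt t))
      (((he_cont.add continuous_const).div_const 2).intervalIntegrable (μ := volume) 0 τ)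
    rw [Real.norm_eq_abs] at this
    refine this.trans_eq ?_
    rw [intervalIntegral.integral_div, intervalIntegral.integral_add (he_cont.intervalIntegrable _ _)
      intervalIntegrable_const, intervalIntegral.integral_const, sub_zero, smul_eq_mul]
  have hE : meanEnergy u = τ⁻¹ * ∫ t in (0 : ℝ)..τ, e t := meanEnergy_eq_period_mean hper hτ
  have key : τ * ∫ x, ‖F x‖ ^ 2 ≤ ν * (((∫ t in (0 : ℝ)..τ, e t) + τ * L) / 2) := by
    rw [hid]
    calc -(ν * ∫ t in (0 : ℝ)..τ, ∫ x, ⟪u t x, Torus.laplacian F x⟫_ℝ)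
        ≤ |ν * ∫ t in (0 : ℝ)..τ, ∫ x, ⟪u t x, Torus.laplacian F x⟫_ℝ| := neg_le_abs _
      _ ≤ ν * (((∫ t in (0 : ℝ)..τ, e t) + τ * L) / 2) := by
          rw [abs_mul, abs_of_nonneg hν]; gcongr
  rw [hE]
  have hτinv : 0 < τ⁻¹ := inv_pos.2 hτ
  have := mul_le_mul_of_nonneg_left key hτinv.le
  rw [← mul_assoc, inv_mul_cancel₀ hτ.ne', one_mul] at this
  refine this.trans_eq ?_
  have hI : τ⁻¹ * (τ * L) = L := by rw [← mul_assoc, inv_mul_cancel₀ hτ.ne', one_mul]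
  calc τ⁻¹ * (ν * (((∫ t in (0 : ℝ)..τ, e t) + τ * L) / 2))
      = ν / 2 * (τ⁻¹ * (∫ t in (0 : ℝ)..τ, e t) + τ⁻¹ * (τ * L)) := by ring
    _ = ν / 2 * (τ⁻¹ * (∫ t in (0 : ℝ)..τ, e t) + L) := by rw [hI]

/-! ### The Laplacian bound of the designer force and the Stokes kill -/

variable {S : Finset (Fin 3 → ℤ)} {E ε : ℝ}

/-- The LAPLACIAN BOUND `Λ₂(c) = ∑ᵢ ∑_{k∈S} (2π kᵢ)² ‖c k‖ ≥ ‖Δf_c‖_∞`. -/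
def lapBound (S : Finset (Fin 3 → ℤ)) (c : ↥S → (EuclideanSpace ℂ (Fin 3))) : ℝ :=
  ∑ i : Fin 3, ∑ k : ↥S, (2 * Real.pi * |(((k : Fin 3 → ℤ) i : ℤ) : ℝ)|) ^ 2 * ‖c k‖

/-- `0 ≤ Λ₂(c)`. -/
theorem lapBound_nonneg (S : Finset (Fin 3 → ℤ)) (c : ↥S → (EuclideanSpace ℂ (Fin 3))) : 0 ≤ lapBound S c :=
  Finset.sum_nonneg fun _ _ => Finset.sum_nonneg fun _ _ => by positivity

/-- `Λ₂(c) ≤ Λ₂(S) ‖c‖`, `Λ₂(S) = ∑ᵢ ∑_{k∈S} (2π kᵢ)²`. -/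
theorem lapBound_le (S : Finset (Fin 3 → ℤ)) (c : ↥S → (EuclideanSpace ℂ (Fin 3))) :
    lapBound S c ≤ (∑ i : Fin 3, ∑ k : ↥S, (2 * Real.pi * |(((k : Fin 3 → ℤ) i : ℤ) : ℝ)|) ^ 2) * ‖c‖ := by
  unfold lapBound
  rw [Finset.sum_mul]
  refine Finset.sum_le_sum fun i _ => ?_
  rw [Finset.sum_mul]
  refine Finset.sum_le_sum fun k _ => ?_
  gcongr
  exact norm_le_pi_norm c k

/-- `‖Δ f_c(x)‖ ≤ Λ₂(c)` pointwise. -/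
theorem norm_laplacian_force_le (S : Finset (Fin 3 → ℤ)) (c : ↥S → (EuclideanSpace ℂ (Fin 3))) (x : (UnitAddTorus (Fin 3))) :
    ‖Torus.laplacian (force S c) x‖ ≤ lapBound S c := by
  rw [Torus.laplacian_eq_sum_partialDeriv_partialDeriv (isSmooth_force S c)]
  refine (norm_sum_le _ _).trans ?_
  unfold lapBound
  refine Finset.sum_le_sum fun i _ => ?_
  unfold force
  rw [Torus.partialDeriv_realTrigPoly', Torus.partialDeriv_realTrigPoly, Torus.realTrigPoly_apply]
  refine (norm_realPart_le _).trans ((norm_trigPoly_apply_le S _ x).trans ?_)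
  rw [← Finset.sum_coe_sort]
  refine Finset.sum_le_sum fun k _ => ?_
  rw [norm_smul, norm_smul, Torus.coeffExt_coe]
  have h1 : ‖(2 * Real.pi * Complex.I * ((k : Fin 3 → ℤ) i : ℂ))‖ = 2 * Real.pi * |(((k : Fin 3 → ℤ) i : ℤ) : ℝ)| := by
    rw [norm_mul, norm_mul, norm_mul, Complex.norm_I, mul_one, Complex.norm_intCast, Complex.norm_ofNat,
      Complex.norm_real, Real.norm_eq_abs, abs_of_pos Real.pi_pos]
  rw [h1, ← mul_assoc, ← sq]
  gcongr
  exact norm_lerayCoeff_le _ _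

/-- `∫‖Δ f_c‖² ≤ Λ₂(c)²` (unit-volume torus). -/
theorem integral_norm_sq_laplacian_force_le (S : Finset (Fin 3 → ℤ)) (c : ↥S → (EuclideanSpace ℂ (Fin 3))) :
    ∫ x, ‖Torus.laplacian (force S c) x‖ ^ 2 ≤ lapBound S c ^ 2 := by
  have h0 := lapBound_nonneg S c
  calc ∫ x, ‖Torus.laplacian (force S c) x‖ ^ 2 ≤ ∫ _ : (UnitAddTorus (Fin 3)), lapBound S c ^ 2 := by
        refine integral_mono (isSmooth_force S c).laplacian.norm_sq.integrable (integrable_const _) fun x => ?_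
        dsimp only
        gcongr
        exact norm_laplacian_force_le S c x
    _ = lapBound S c ^ 2 := by simp

/-- STOKES LEVEL SHELL: `c ∈ sLOUD_j(S,E,ε)`, `0 ≤ ε` ⇒ `0 ≤ E` and `ε² ≤ E(E + Λ₂(c)²)/(2(j+1))`. -/
theorem stokes_shell (hε : 0 ≤ ε) {j : ℕ} {c : ↥S → (EuclideanSpace ℂ (Fin 3))} (hc : c ∈ stokesLoudSet S E ε j) :
    0 ≤ E ∧ ε ^ 2 ≤ E * (E + lapBound S c ^ 2) / (2 * ((j : ℝ) + 1)) := by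
  obtain ⟨ν, hν, hνj, τ, u, p, hτ, hsol, hper, hEu, hεu⟩ := hc
  have hmE := meanEnergy_nonneg' hper hτ
  have hE : 0 ≤ E := hmE.trans hEu
  refine ⟨hE, ?_⟩
  have hj : (0 : ℝ) < (j : ℝ) + 1 := by positivity
  have hA : 0 ≤ ∫ x, ‖force S c x‖ ^ 2 := integral_nonneg fun _ => sq_nonneg _
  have h1 : ε ^ 2 ≤ (∫ x, ‖force S c x‖ ^ 2) * E :=
    calc ε ^ 2 ≤ meanDissipation ν u ^ 2 := by gcongr
      _ ≤ (∫ x, ‖force S c x‖ ^ 2) * meanEnergy u := hsol.meanDissipation_sq_le hν.le hper hτ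
      _ ≤ (∫ x, ‖force S c x‖ ^ 2) * E := mul_le_mul_of_nonneg_left hEu hA
  have h2 : ∫ x, ‖force S c x‖ ^ 2 ≤ (E + lapBound S c ^ 2) / (2 * ((j : ℝ) + 1)) :=
    calc ∫ x, ‖force S c x‖ ^ 2 ≤ ν / 2 * (meanEnergy u + ∫ x, ‖Torus.laplacian (force S c) x‖ ^ 2) :=
          hsol.forceEnergy_le hν.le (isDivFree_force S c) hper hτ
      _ ≤ ν / 2 * (E + lapBound S c ^ 2) := by
          gcongr
          exact integral_norm_sq_laplacian_force_le S c
      _ ≤ (1 / ((j : ℝ) + 1)) / 2 * (E + lapBound S c ^ 2) := by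
          gcongr
      _ = (E + lapBound S c ^ 2) / (2 * ((j : ℝ) + 1)) := by
          field_simp
  calc ε ^ 2 ≤ (∫ x, ‖force S c x‖ ^ 2) * E := h1
    _ ≤ (E + lapBound S c ^ 2) / (2 * ((j : ℝ) + 1)) * E := mul_le_mul_of_nonneg_right h2 hE
    _ = E * (E + lapBound S c ^ 2) / (2 * ((j : ℝ) + 1)) := by ring

/-- THE CRUX IS FALSE WITHOUT CONVECTION ("any proof must use `(u·∇)u`"): for EVERY stock, all budgets and
every open non-empty `U`, the Stokes loud sets fail to be dense in `U` at all large levels — indeed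
`sLOUD_j ∩ B` is EMPTY for every bounded `B` once `2(j+1) ε² > E(E + Λ₂(S)²(sup_B ‖c‖)²)`. -/
theorem denseLoudDesignerForces_false_without_convection : ¬ DenseLoudDesignerForcesWithoutConvection := by
  intro h
  obtain ⟨S, -, E, ε, hε, U, hU, ⟨c, hc⟩, hW⟩ := h ∅
  set L2 : ℝ := ∑ i : Fin 3, ∑ k : ↥S, (2 * Real.pi * |(((k : Fin 3 → ℤ) i : ℤ) : ℝ)|) ^ 2 with hL2
  have hL2n : 0 ≤ L2 := Finset.sum_nonneg fun _ _ => Finset.sum_nonneg fun _ _ => by positivity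
  set C : ℝ := L2 * (‖c‖ + 1) with hC
  -- at every level there is a Stokes-loud `c_j` within distance 1 of `c`
  have hnear : ∀ j : ℕ, ∃ c' ∈ stokesLoudSet S E ε j, dist c' c < 1 := by
    intro j
    have := Metric.mem_closure_iff.1 (hW j hc) 1 one_pos
    obtain ⟨c', hc', hd⟩ := this
    exact ⟨c', hc', by rwa [dist_comm]⟩
  -- hence `ε² ≤ E(E + C²)/(2(j+1))` for every `j`
  have hlevel : ∀ j : ℕ, 0 ≤ E ∧ ε ^ 2 ≤ E * (E + C ^ 2) / (2 * ((j : ℝ) + 1)) := by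
    intro j
    obtain ⟨c', hc', hd⟩ := hnear j
    obtain ⟨hE, hsh⟩ := stokes_shell hε.le hc'
    refine ⟨hE, hsh.trans ?_⟩
    have hn : ‖c'‖ ≤ ‖c‖ + 1 := by
      calc ‖c'‖ ≤ ‖c‖ + ‖c' - c‖ := norm_le_norm_add_norm_sub' c' c
        _ ≤ ‖c‖ + 1 := by rw [← dist_eq_norm]; linarith
    have hlap : lapBound S c' ≤ C := (lapBound_le S c').trans (mul_le_mul_of_nonneg_left hn hL2n)
    have hj : (0 : ℝ) < 2 * ((j : ℝ) + 1) := by positivity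
    gcongr
    exact lapBound_nonneg S c'
  -- let `j → ∞`
  have hE := (hlevel 0).1
  have hsq : ε ^ 2 ≤ 0 := by
    refine le_of_forall_pos_le_add fun δ hδ => ?_
    obtain ⟨j, hj⟩ := exists_nat_gt (E * (E + C ^ 2) / (2 * δ))
    have h1 := (hlevel j).2
    have hj1 : (0 : ℝ) < 2 * ((j : ℝ) + 1) := by positivity
    have hK : E * (E + C ^ 2) / (2 * ((j : ℝ) + 1)) ≤ δ := by
      rw [div_le_iff₀ hj1]
      have h2 : E * (E + C ^ 2) / (2 * δ) < (j : ℝ) + 1 := hj.trans (lt_add_one _)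
      rw [div_lt_iff₀ (by positivity)] at h2
      linarith
    linarith
  nlinarith

end Stokes

end Summit.AnomalousDissipation.AnomalousDissipation.Theorems.DenseLoudDesignerForces.Negative

end
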